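import Summits.KontsevichZagierPeriods.KontsevichZagierPeriods.Theorems.RootDecompWalshStrataBallTerminals

/-!
# Ball-cube descent 6/7: the disc and annulus atoms; `sqrtDescent₂_ball` on ALL atoms

Gen 5 of the decomposition node `WalshStrata` (route `RootDecompWalshStrata`, support item
`QuadricBakerDescent` stmt-KontsevichZagierPeriods-27597, its `d = 3` slice): the first two-variable
`√(quadratic)` weight over CUBE-CUT cells decided inside KZ's rules (1)–(3) over `ℚ` —
`sqrtDescent₂_ball : ∀ γ, SqrtDescent₂ K₇ γ` (part 6) for the ball quadric `P = 7/4 − x² − y² − z²`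
(`D = 7 − 4x² − 4y²`; atoms = the disc `x² + y² < 3/4` and the annulus `3/4 < x² + y² < 7/4` cut by
the faces `x = 1`, `y = 1`, plus null/empty/zero-weight atoms), and the corollary
`ballCube_bakerDescent` (part 7): `(d, P, q) = (3, 7/4 − Σxᵢ², q)` is an instance of
`QuadricBakerDescent` for every `q ∈ ℚ`.  Mechanism: the fibrewise vertex chart
`(v, x) ↦ (x, s(x)·v/(1 + v²))`, `s = √(7 − 4x²)`, makes `√D·|det| = (7 − 4x²)(1 − v²)²/(1 + v²)³`
RATIONAL; Newton–Leibniz in `x` over an arbitrary semialgebraic base (the landed band identity); the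
`√(7 − 4x²)`-CANCELLATION on the algebraic edges `x² = β(v)` (circle) and `x² = α(v)` (face `y = 1`)
under the charts `v₁ = 2p/(s + 2)`, `v₂ = 2/(s + 2p)` (`p = √(3/4 − x²)`) reduces both boundary terms to
`E(x²)·√(3/4 − x²)`, `E ∈ ℚ(X)`, hence to rational integrands by the Euler chart of `x² + y² = 3/4`.
This part: the typed target `SqrtDescent₂ K γ` (verbatim from the lens file §21: every 2-dim
representation on an adapted atom of `K` with integrand `γ√D_K` is in the Baker sector mod relations),
`inBaker_R₁` (`[R₁, c√D]`: chart, band identity over `V₁` with edges `0`, `√β`, boundary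
term `T₁`), `inBaker_R₂` (`[R₂, c√D]`: chart, band identity over `(0,1)` with edges `√max(α,β)`, `1`,
base split `{β > 0} ∪ {α > 0 ≥ β} ∪ {α, β ≤ 0}`), the atom dictionary `mem_atom_K₇`, and
**`sqrtDescent₂_ball : ∀ γ, SqrtDescent₂ K₇ γ`** (every sign vector `σ`: zero weight when `σ₀ ≠ 1`,
empty or null circle otherwise unless the atom is `R₁` or `R₂`).  Imports: part 5; 0 sorry.
[KontsevichZagier2001 §1.2; this node, gen 5]
-/

noncomputable section

open Literature.NumberTheory.Transcendental
open MeasureTheory Set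
open MvPolynomial (aeval X C)
open Literature.ModelTheory.ExponentialFields (IsSemialgebraic isSemialgebraic_univ
  isSemialgebraic_setOf_eval_pos isSemialgebraic_setOf_eval_lt isSemialgebraic_setOf_eval_le
  isSemialgebraic_setOf_eval_nonneg isSemialgebraic_setOf_eval_eq_zero continuous_aeval_real
  tarski_seidenberg_real_holds)
open Summit.KontsevichZagierPeriods.RootDecompWalshStrata.WalshSpanProof (isSemialgebraic_cubeSet
  isBounded_cubeSet)
open Summit.KontsevichZagierPeriods.RootDecompWalshStrata.ConeSpecimen (unitIoo isSemialgebraic_unitIoo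
  unitIoo_subset_Icc mem_unitIoo)
open Summit.KontsevichZagierPeriods.RootDecompWalshStrata.PointlessOctant (boxTwo isSemialgebraic_boxTwo
  boxTwo_subset_Icc euler_inj)

namespace Summit.KontsevichZagierPeriods.RootDecompWalshStrata.ConicDescent.BallCube

/-! #### 21b. The typed target `SqrtDescent₂` (lens file §21; tagged `@[conjecture]` — open for general `K`, decided for `K₇` below) -/

/-- **Two-variable square-root descent on ADAPTED atoms** (the gen-5 deciding statement of the node,
typed in the lens file `WalshStrata.lean` §21): for a quadric normal form `K` and `γ ∈ ℚ`, every
two-dimensional representation whose domain is an atom of `K`'s adapted sign algebra in `(0,1)²` and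
whose integrand is `γ·√D_K(x,y)` lands in the Baker sector modulo relations.  Decided below for the
cube-cut ball specimen `K₇` (`sqrtDescent₂_ball`, part 6).  Deliberately NOT stated for arbitrary
semialgebraic bases (elliptic obstruction: `∫∫_X √(1 − x² − y²)` over a generic semialgebraic `X` has
genus-1 boundary periods). [KontsevichZagier2001 §1.2; this node, gen 5] -/
@[conjecture] def SqrtDescent₂ (K : Quadric₃) (γ : ℚ) : Prop :=
  ∀ (σ : Fin 5 → SignType) (r : KZ.IntegralRep 2), r.domain = K.atom σ →
    EqOn r.integrand (fun v => (γ : ℝ) * √(K.Dxy (v 0) (v 1))) r.domain → InBaker (KZ.of r)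

/-! #### 23.11 The disc piece `R₁` and the annulus piece `R₂` -/

/-- `Fin.init z 0 = z 0` on `Fin 2` (file-local rfl helper). [folklore] -/
@[simp] private theorem init_apply_zero₂ (z : Fin 2 → ℝ) : Fin.init z 0 = z 0 := rfl

/-- `Fin.last 1 = 1` (file-local rfl helper). [folklore] -/
@[simp] private theorem last_one₂ : (Fin.last 1 : Fin 2) = 1 := rfl

/-- The constant `1` is `ℚ`-semialgebraic on a `ℚ`-semialgebraic set (file-local copy). [BCR1998 §2.2] -/
private theorem isSemialgebraicFunOn_one {N : ℕ} {X : Set (Fin N → ℝ)} (hX : IsSemialgebraic ℚ X) :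
    IsSemialgebraicFunOn ℚ X fun _ => (1 : ℝ) :=
  (isSemialgebraicFunOn_ratCast hX 1).congr fun _ _ => Rat.cast_one

/-- The constant `0` is `ℚ`-semialgebraic on a `ℚ`-semialgebraic set (file-local copy). [BCR1998 §2.2] -/
private theorem isSemialgebraicFunOn_zero {N : ℕ} {X : Set (Fin N → ℝ)} (hX : IsSemialgebraic ℚ X) :
    IsSemialgebraicFunOn ℚ X fun _ => (0 : ℝ) :=
  (isSemialgebraicFunOn_ratCast hX 0).congr fun _ _ => Rat.cast_zero

/-- Lemma `V₁_subset_Icc` of the ball-cube descent (gen 5; see the section docstring). [this node] -/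
theorem V₁_subset_Icc : V₁ ⊆ Icc 0 1 := V₁_subset.trans unitIoo_subset_Icc

/-- **The disc piece:** `[R₁, c√(7 − 4x² − 4y²)]` is in the Baker sector. -/
theorem inBaker_R₁ (c : ℚ) (r : KZ.IntegralRep 2) (hdom : r.domain = R₁)
    (hint : ∀ u ∈ r.domain, r.integrand u = (c : ℝ) * √(7 - 4 * u 0 ^ 2 - 4 * u 1 ^ 2)) :
    InBaker (KZ.of r) := by
  -- (2): the chart
  have hchart := vxRep_sub_sqrtDRep_mem_relations Ω₁ R₁ isSemialgebraic_Ω₁ Ω₁_subset_boxTwo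
    isSemialgebraic_R₁ R₁_subset_boxTwo image_chΦ_Ω₁ c
  -- (3): Newton–Leibniz in `x` over `V₁`, edges `0` and `√β`
  have hu : IsSemialgebraicFunOn ℚ V₁ fun w => √(chβ (w 0)) :=
    IsSemialgebraicFunOn.sqrt_holds (isSemialgebraicFunOn_chβ.mono V₁_subset isSemialgebraic_V₁)
  have hV₁b : Bornology.IsBounded V₁ :=
    (isCompact_Icc (a := (0 : Fin 1 → ℝ)) (b := 1)).isBounded.subset V₁_subset_Icc
  have hu1 : ∀ w ∈ V₁, √(chβ (w 0)) ≤ 1 := fun w hw => by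
    obtain ⟨⟨hv0, hv1⟩, hβ⟩ := mem_V₁.1 hw
    have h := chβ_lt hv0.ne' (by nlinarith)
    rw [Real.sqrt_le_one]; linarith
  set τ : KZ.IntegralRep 1 := bddRep V₁ isSemialgebraic_V₁ hV₁b (fun w => chF c (√(chβ (w 0))) (w 0))
    (isSemialgebraicFunOn_chF isSemialgebraic_V₁ hu c) (|(c : ℝ)| * 9) (fun w hw => by
      have h := mem_unitIoo.1 (V₁_subset hw)
      exact abs_chF_le c (Real.sqrt_nonneg _) (hu1 w hw) h.1.le h.2.le) with hτ
  have hband := band_move isSemialgebraic_V₁ V₁_subset_Icc (isSemialgebraicFunOn_zero isSemialgebraic_V₁)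
    hu (fun _ _ => le_rfl) (fun _ _ => Real.sqrt_nonneg _) hu1 c
    (vxRep Ω₁ isSemialgebraic_Ω₁ Ω₁_subset_boxTwo c) rfl (fun z _ => rfl) τ rfl
    (fun w _ => by simp [hτ])
  -- the boundary term
  have hT : InBaker (KZ.of τ) := inBaker_T₁ c τ (fun _ hw => hw) fun w _ => rfl
  have hvx : InBaker (KZ.of (vxRep Ω₁ isSemialgebraic_Ω₁ Ω₁_subset_boxTwo c)) := hT.congr hband
  have hsq : InBaker (KZ.of (sqrtDRep R₁ isSemialgebraic_R₁ R₁_subset_boxTwo c)) := by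
    refine hvx.congr ?_
    have : KZ.of (sqrtDRep R₁ isSemialgebraic_R₁ R₁_subset_boxTwo c) -
        KZ.of (vxRep Ω₁ isSemialgebraic_Ω₁ Ω₁_subset_boxTwo c) =
        -(KZ.of (vxRep Ω₁ isSemialgebraic_Ω₁ Ω₁_subset_boxTwo c) -
          KZ.of (sqrtDRep R₁ isSemialgebraic_R₁ R₁_subset_boxTwo c)) := by abel
    rw [this]
    exact KZ.relations.neg_mem hchart
  exact hsq.congr (KZ.of_sub_of_mem_relations_of_eqOn (by rw [hdom]; rfl) fun u hu => hint u hu)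

/-- `β > 0 ⇒ α < 0` (`V₁` and `V₃` are disjoint). -/
theorem chα_neg_of_chβ_pos {v : ℝ} (hv0 : 0 < v) (hv1 : v < 1) (hβ : 0 < chβ v) : chα v < 0 := by
  have hv2 : 0 < 1 - v ^ 2 := by nlinarith
  have h4 : 0 < 4 * (1 - v ^ 2) ^ 2 := by positivity
  have h4' : 0 < 4 * v ^ 2 := by positivity
  rw [chβ, lt_div_iff₀ h4, zero_mul] at hβ
  rw [chα, div_lt_iff₀ h4', zero_mul]
  nlinarith [sq_nonneg v]

/-- **The annulus piece:** `[R₂, c√(7 − 4x² − 4y²)]` is in the Baker sector. -/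
theorem inBaker_R₂ (c : ℚ) (r : KZ.IntegralRep 2) (hdom : r.domain = R₂)
    (hint : ∀ u ∈ r.domain, r.integrand u = (c : ℝ) * √(7 - 4 * u 0 ^ 2 - 4 * u 1 ^ 2)) :
    InBaker (KZ.of r) := by
  -- (2): the chart
  have hchart := vxRep_sub_sqrtDRep_mem_relations Ω₂ R₂ isSemialgebraic_Ω₂ Ω₂_subset_boxTwo
    isSemialgebraic_R₂ R₂_subset_boxTwo image_chΦ_Ω₂ c
  -- (3): Newton–Leibniz in `x` over `(0,1)`, edges `√(max α β)` and `1`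
  have hl : IsSemialgebraicFunOn ℚ unitIoo fun w => √(max (chα (w 0)) (chβ (w 0))) :=
    IsSemialgebraicFunOn.sqrt_holds isSemialgebraicFunOn_maxαβ
  have hIb : Bornology.IsBounded unitIoo :=
    (isCompact_Icc (a := (0 : Fin 1 → ℝ)) (b := 1)).isBounded.subset unitIoo_subset_Icc
  have hmax1 : ∀ w ∈ unitIoo, max (chα (w 0)) (chβ (w 0)) ≤ 1 := fun w hw => by
    obtain ⟨hv0, hv1⟩ := mem_unitIoo.1 hw
    have hv2 : w 0 ^ 2 ≠ 1 := by nlinarith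
    exact max_le (by linarith [chα_lt hv0.ne' hv2]) (by linarith [chβ_lt hv0.ne' hv2])
  have hl1 : ∀ w ∈ unitIoo, √(max (chα (w 0)) (chβ (w 0))) ≤ 1 := fun w hw => by
    rw [Real.sqrt_le_one]; exact hmax1 w hw
  set τ : KZ.IntegralRep 1 := bddRep unitIoo isSemialgebraic_unitIoo hIb
    (fun w => chF c 1 (w 0) - chF c (√(max (chα (w 0)) (chβ (w 0)))) (w 0))
    (IsSemialgebraicFunOn.sub_holds (isSemialgebraicFunOn_chF isSemialgebraic_unitIoo
      (isSemialgebraicFunOn_one isSemialgebraic_unitIoo) c)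
      (isSemialgebraicFunOn_chF isSemialgebraic_unitIoo hl c))
    (|(c : ℝ)| * 9 + |(c : ℝ)| * 9) (fun w hw => by
      have h := mem_unitIoo.1 hw
      exact (abs_sub _ _).trans (add_le_add (abs_chF_le c zero_le_one le_rfl h.1.le h.2.le)
        (abs_chF_le c (Real.sqrt_nonneg _) (hl1 w hw) h.1.le h.2.le))) with hτ
  have hband := band_move isSemialgebraic_unitIoo unitIoo_subset_Icc hl
    (isSemialgebraicFunOn_one isSemialgebraic_unitIoo) (fun _ _ => Real.sqrt_nonneg _) hl1
    (fun _ _ => le_rfl) c (vxRep Ω₂ isSemialgebraic_Ω₂ Ω₂_subset_boxTwo c) rfl (fun z _ => rfl) τ rfl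
    (fun w _ => by simp [hτ])
  -- the base splits as `V₁ ∪ {β ≤ 0}`; `{β ≤ 0}` splits as `{α > 0} ∪ {α ≤ 0, β ≤ 0}`
  set B : Set (Fin 1 → ℝ) := {w | w ∈ unitIoo ∧ 0 ≤ -chβ (w 0)} with hBdef
  have hBs : IsSemialgebraic ℚ B :=
    IsSemialgebraicFunOn.isSemialgebraic_sep_nonneg isSemialgebraicFunOn_chβ.neg
  have hBsub : B ⊆ unitIoo := fun _ hw => hw.1
  set B₃ : Set (Fin 1 → ℝ) := {w | w ∈ B ∧ 0 < chα (w 0)} with hB₃def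
  have hB₃s : IsSemialgebraic ℚ B₃ :=
    IsSemialgebraicFunOn.isSemialgebraic_sep_pos (isSemialgebraicFunOn_chα.mono hBsub hBs)
  set B₂ : Set (Fin 1 → ℝ) := {w | w ∈ B ∧ 0 ≤ -chα (w 0)} with hB₂def
  have hB₂s : IsSemialgebraic ℚ B₂ :=
    IsSemialgebraicFunOn.isSemialgebraic_sep_nonneg (isSemialgebraicFunOn_chα.mono hBsub hBs).neg
  have hτd : τ.domain = unitIoo := rfl
  have hcov : τ.domain = V₁ ∪ B := by
    rw [hτd]
    ext w
    constructor
    · intro hw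
      rcases lt_or_ge 0 (chβ (w 0)) with h | h
      · exact Or.inl ⟨hw, h⟩
      · exact Or.inr ⟨hw, by linarith⟩
    · rintro (⟨hw, _⟩ | ⟨hw, _⟩) <;> exact hw
  have hV₁r : V₁ ⊆ τ.domain := fun w hw => hcov ▸ Or.inl hw
  have hBr : B ⊆ τ.domain := fun w hw => hcov ▸ Or.inr hw
  have hτi : ∀ w, τ.integrand w = chF c 1 (w 0) - chF c (√(max (chα (w 0)) (chβ (w 0)))) (w 0) :=
    fun w => rfl
  refine InBaker.congr (x := KZ.of (vxRep Ω₂ isSemialgebraic_Ω₂ Ω₂_subset_boxTwo c)) ?_ ?_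
  swap
  · -- `[r] − [vxRep]` is a relation
    have h1 : KZ.of r - KZ.of (sqrtDRep R₂ isSemialgebraic_R₂ R₂_subset_boxTwo c) ∈ KZ.relations :=
      KZ.of_sub_of_mem_relations_of_eqOn (by rw [hdom]; rfl) fun u hu => hint u hu
    have : KZ.of r - KZ.of (vxRep Ω₂ isSemialgebraic_Ω₂ Ω₂_subset_boxTwo c) =
        (KZ.of r - KZ.of (sqrtDRep R₂ isSemialgebraic_R₂ R₂_subset_boxTwo c)) -
          (KZ.of (vxRep Ω₂ isSemialgebraic_Ω₂ Ω₂_subset_boxTwo c) -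
            KZ.of (sqrtDRep R₂ isSemialgebraic_R₂ R₂_subset_boxTwo c)) := by abel
    rw [this]
    exact KZ.relations.sub_mem h1 hchart
  refine InBaker.congr (x := KZ.of τ) ?_ hband
  refine InBaker.of_split τ isSemialgebraic_V₁ hBs hV₁r hBr hcov ?_ ?_ ?_
  · have : V₁ ∩ B = ∅ := by
      ext w
      refine ⟨fun hw => ?_, fun h => h.elim⟩
      have h1 : 0 < chβ (w 0) := hw.1.2
      have h2 : 0 ≤ -chβ (w 0) := hw.2.2
      exact False.elim (by linarith)
    rw [this, measure_empty]
  · -- on `V₁`: `max = β`, the circle term (with `−c`)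
    refine inBaker_of_chF_one_sub c _ (fun w hw => V₁_subset hw) (fun w => √(chβ (w 0)))
      (fun w hw => ?_) fun r' hr'd hr'i => inBaker_T₁ (-c) r' (by rw [hr'd]; exact fun _ h => h) hr'i
    obtain ⟨⟨hv0, hv1⟩, hβ⟩ := mem_V₁.1 hw
    have hα := chα_neg_of_chβ_pos hv0 hv1 hβ
    show τ.integrand w = _
    rw [hτi, max_eq_right (by linarith)]
  · -- on `B = {β ≤ 0}`: split further along the sign of `α`
    have hcov' : (τ.restrict B hBs hBr).domain = B₃ ∪ B₂ := by
      show B = B₃ ∪ B₂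
      ext w
      constructor
      · intro hw
        rcases lt_or_ge 0 (chα (w 0)) with h | h
        · exact Or.inl ⟨hw, h⟩
        · exact Or.inr ⟨hw, by linarith⟩
      · rintro (⟨hw, _⟩ | ⟨hw, _⟩) <;> exact hw
    refine InBaker.of_split _ hB₃s hB₂s (fun w hw => hcov' ▸ Or.inl hw) (fun w hw => hcov' ▸ Or.inr hw)
      hcov' ?_ ?_ ?_
    · have : B₃ ∩ B₂ = ∅ := by
        ext w
        refine ⟨fun hw => ?_, fun h => h.elim⟩
        have h1 : 0 < chα (w 0) := hw.1.2
        have h2 : 0 ≤ -chα (w 0) := hw.2.2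
        exact False.elim (by linarith)
      rw [this, measure_empty]
    · -- `α > 0 ≥ β`: the face term (with `−c`)
      refine inBaker_of_chF_one_sub c _ (fun w hw => hBsub hw.1) (fun w => √(chα (w 0)))
        (fun w hw => ?_) fun r' hr'd hr'i => inBaker_T₃ (-c) r' (by
          rw [hr'd]; exact fun w hw => ⟨hBsub hw.1, hw.2⟩) hr'i
      have hα : 0 < chα (w 0) := hw.2
      have hβ : 0 ≤ -chβ (w 0) := hw.1.2
      show τ.integrand w = _
      rw [hτi, max_eq_left (by linarith)]
    · -- `α ≤ 0`, `β ≤ 0`: the lower edge is `0`, the integrand `F(1, v)` is rational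
      refine inBaker_of_chF_one_sub c _ (fun w hw => hBsub hw.1) (fun _ => 0)
        (fun w hw => ?_) fun r' _ hr'i =>
          InBaker.of_mem_relations (KZ.of_mem_relations_of_eqOn_zero r' fun w hw => by
            rw [hr'i w hw]; simp)
      have hα : 0 ≤ -chα (w 0) := hw.2
      have hβ : 0 ≤ -chβ (w 0) := hw.1.2
      have h0 : √(max (chα (w 0)) (chβ (w 0))) = 0 :=
        Real.sqrt_eq_zero'.2 (max_le (by linarith) (by linarith))
      show τ.integrand w = _
      rw [hτi, h0]

/-! #### 23.12 All atoms: `SqrtDescent₂ K₇ γ` -/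

/-- Membership in an atom of `K₇`: the explicit description of the adapted atoms of the cube-cut ball quadric `7/4 − x² − y² − z²`. -/
theorem mem_atom_K₇ {σ : Fin 5 → SignType} {u : Fin 2 → ℝ} :
    u ∈ K₇.atom σ ↔ (∀ j, 0 < u j ∧ u j < 1) ∧ SignType.sign (7 - 4 * u 0 ^ 2 - 4 * u 1 ^ 2) = σ 0 ∧
      SignType.sign (7 / 4 - u 0 ^ 2 - u 1 ^ 2) = σ 1 ∧
      SignType.sign (3 / 4 - u 0 ^ 2 - u 1 ^ 2) = σ 2 ∧ (0 : SignType) = σ 3 ∧ (-1 : SignType) = σ 4 := by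
  simp only [Quadric₃.atom, mem_setOf_eq]
  refine and_congr_right fun _ => ?_
  constructor
  · intro h
    refine ⟨by rw [← h 0, K₇_adapted₀], by rw [← h 1, K₇_adapted₁], by rw [← h 2, K₇_adapted₂],
      by rw [← h 3, K₇_adapted₃, sign_zero], by rw [← h 4, K₇_adapted₄, sign_neg (by norm_num)]⟩
  · rintro ⟨h0, h1, h2, h3, h4⟩ i
    fin_cases i
    · show SignType.sign (K₇.adapted 0 u) = σ 0
      rw [K₇_adapted₀]; exact h0
    · show SignType.sign (K₇.adapted 1 u) = σ 1
      rw [K₇_adapted₁]; exact h1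
    · show SignType.sign (K₇.adapted 2 u) = σ 2
      rw [K₇_adapted₂]; exact h2
    · show SignType.sign (K₇.adapted 3 u) = σ 3
      rw [K₇_adapted₃, sign_zero]; exact h3
    · show SignType.sign (K₇.adapted 4 u) = σ 4
      rw [K₇_adapted₄, sign_neg (by norm_num)]; exact h4

/-- **Gen-5 target, PROVED: `SqrtDescent₂ K₇ γ` — the ball-in-cube specimen on all its atoms.**
The atoms with `D ≤ 0` carry the zero integrand; the circle atom is null; the empty atoms are
null; the disc and annulus atoms are `inBaker_R₁`, `inBaker_R₂` (fibrewise vertex chart, rule (3)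
in `x`, `√(7 − 4x²)`-cancellation, Euler chart). [this node, gen 5] -/
theorem sqrtDescent₂_ball (γ : ℚ) : SqrtDescent₂ K₇ γ := by
  intro σ r hd hi
  have hi' : ∀ u ∈ r.domain, r.integrand u = (γ : ℝ) * √(7 - 4 * u 0 ^ 2 - 4 * u 1 ^ 2) :=
    fun u hu => by rw [hi hu]; simp only [K₇_Dxy]
  have hmem : ∀ u, u ∈ r.domain ↔ (∀ j, 0 < u j ∧ u j < 1) ∧
      SignType.sign (7 - 4 * u 0 ^ 2 - 4 * u 1 ^ 2) = σ 0 ∧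
      SignType.sign (7 / 4 - u 0 ^ 2 - u 1 ^ 2) = σ 1 ∧
      SignType.sign (3 / 4 - u 0 ^ 2 - u 1 ^ 2) = σ 2 ∧ (0 : SignType) = σ 3 ∧ (-1 : SignType) = σ 4 :=
    fun u => by rw [hd]; exact mem_atom_K₇
  -- empty atoms
  rcases eq_empty_or_nonempty r.domain with hemp | ⟨u₀, hu₀⟩
  · exact InBaker.of_mem_relations
      (KZ.of_mem_relations_of_volume_eq_zero r (by rw [hemp, measure_empty]))
  obtain ⟨hb₀, hs0, hs1, hs2, hs3, hs4⟩ := (hmem u₀).1 hu₀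
  -- atoms with `D ≤ 0`: the integrand vanishes
  by_cases hD : σ 0 = 1
  swap
  · refine InBaker.of_mem_relations (KZ.of_mem_relations_of_eqOn_zero r fun u hu => ?_)
    obtain ⟨-, h0, -⟩ := (hmem u).1 hu
    have hle : 7 - 4 * u 0 ^ 2 - 4 * u 1 ^ 2 ≤ 0 := by
      by_contra h
      push Not at h
      exact hD (by rw [← h0, sign_pos h])
    rw [hi' u hu, Real.sqrt_eq_zero'.2 hle, mul_zero]
    rfl
  -- `D > 0` on the (nonempty) atom; hence `C = D/4 > 0`, `σ 1 = 1`
  have hD₀ : 0 < 7 - 4 * u₀ 0 ^ 2 - 4 * u₀ 1 ^ 2 := by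
    rw [hD, sign_eq_one_iff] at hs0; exact hs0
  have hσ1 : σ 1 = 1 := by rw [← hs1]; exact sign_pos (by linarith)
  -- split along `σ 2 = sign(3/4 − x² − y²)`
  rcases hσ2 : σ 2 with _ | _ | _
  · -- `σ 2 = 0`: the null circle
    have hu : IsSemialgebraicFunOn ℚ unitIoo fun w => √(3 / 4 - w 0 ^ 2) :=
      (IsSemialgebraicFunOn.sqrt_holds (isSemialgebraicFunOn_aeval isSemialgebraic_unitIoo
        (MvPolynomial.C (3 / 4) - X 0 ^ 2))).congr fun w _ => by
          simp only [map_sub, map_pow, MvPolynomial.aeval_C, MvPolynomial.aeval_X, eq_ratCast]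
          push_cast; ring_nf
    have hG := KZ.volume_graph_eq_zero hu
    refine InBaker.of_mem_relations (KZ.of_mem_relations_of_volume_eq_zero r
      (measure_mono_null (fun u hu' => ?_) hG))
    obtain ⟨hb, -, -, h2, -⟩ := (hmem u).1 hu'
    rw [hσ2, SignType.zero_eq_zero, sign_eq_zero_iff] at h2
    refine ⟨by rw [mem_unitIoo, init_apply_zero₂]; exact hb 0, ?_⟩
    rw [last_one₂, init_apply_zero₂]
    rw [← Real.sqrt_sq (hb 1).1.le]
    congr 1
    linarith
  · -- `σ 2 = −1`: the annulus piece `R₂`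
    refine inBaker_R₂ γ r ?_ hi'
    ext u
    rw [hmem u]
    constructor
    · rintro ⟨hb, h0, -, h2, -⟩
      rw [hD, sign_eq_one_iff] at h0
      rw [hσ2, SignType.neg_eq_neg_one, sign_eq_neg_one_iff] at h2
      exact ⟨hb, by linarith, by linarith⟩
    · rintro ⟨hb, hgt, hlt⟩
      refine ⟨hb, ?_, ?_, ?_, hs3, hs4⟩
      · rw [hD]; exact sign_pos (by linarith)
      · rw [hσ1]; exact sign_pos (by linarith)
      · rw [hσ2, SignType.neg_eq_neg_one]; exact sign_neg (by linarith)
  · -- `σ 2 = 1`: the disc piece `R₁`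
    refine inBaker_R₁ γ r ?_ hi'
    ext u
    rw [hmem u]
    constructor
    · rintro ⟨hb, -, -, h2, -⟩
      rw [hσ2, SignType.pos_eq_one, sign_eq_one_iff] at h2
      exact ⟨hb, by linarith⟩
    · rintro ⟨hb, hlt⟩
      refine ⟨hb, ?_, ?_, ?_, hs3, hs4⟩
      · rw [hD]; exact sign_pos (by linarith)
      · rw [hσ1]; exact sign_pos (by linarith)
      · rw [hσ2, SignType.pos_eq_one]; exact sign_pos (by linarith)

end Summit.KontsevichZagierPeriods.RootDecompWalshStrata.ConicDescent.BallCube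

end
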